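import Mathlib
import HarnessLib

/-!
# Format C, design C∞: the limit-coupling majorant `Uq` with a STRUCTURED (Gram-form) tail

Route context: Fourier–Galerkin / Schur-complement certificates of Weil positivity on a window ("format C";
cell memo `run/shared/lean/pub/rh-explicit/rh-explicit-weil-10/KERNEL-LEVER.md` §19–§20, sizing note
`run/shared/lean/pub/rh-explicit/rh-explicit-weil-2/gen9/CINF-DOOR-SIZING.md` §2; supporting
stmt-RiemannHypothesis-0098; seat rh-explicit-weil-10).

The C∞ front door (`weilPositivityOn_of_formatC_cinf`) asks the data side for ONE majorant of the limit coupling,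
`Σ_{m∈[B,N)} (Σ_i M(i,m)x_i + Σ_j c∞(m,j)β_j)²/d̂_m ≤ Uq(x,β)` for EVERY truncation `N`.  `WeilFormatCDeflatedFarCouplingSplit`
discharged it with an exact middle range plus an ISOTROPIC tail `T·‖z‖²`; the sizing note shows that no isotropic tail can
close a C∞ rung (the worst-direction tail energy exceeds the certificate margin by ≥ 28 orders of magnitude at any affordable
`B₃`), so the tail must be a direction-tracking quadratic form, as in the two-range doors (`TJ`/`MS` designs).  This file is
that bookkeeping, abstractly:

* on `m ≥ B₃` the rows and the images are expanded over a finite set of FAMILY FUNCTIONS `φ_f(m)` (`f : Fin F`) with data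
  coefficient matrices `P`, `Q`, a common unimodular sign `ε(m)` (`ε(m)² = 1`, it drops out of the square) and remainders
  `|M(i,m) − ε(m)Σ_f P(f,i)φ_f(m)| ≤ ρx_i·w(m)`, `|c(m,j) − ε(m)Σ_f Q(f,j)φ_f(m)| ≤ ρβ_j·w(m)`, `Σ_{m∈[B₃,N)} w(m)² ≤ W`;
* ANY Gram majorant `Γ` of the families, `Σ_{m∈[B₃,N)} (Σ_f u_f φ_f(m))² ≤ Γ(u)` for every `N`, `u`
  (the explicit ones are produced by `WeilFormatCFamilyGram`-type lemmas from entry boxes);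
* a floor `d₀ ≤ d̂_m` on `[B₃, ∞)`.

Results:

* `couplingGram_sq_add_le` — Peter–Paul `(t + r)² ≤ (1+θ)t² + (1+θ⁻¹)r²`;
* `couplingGram_weighted_cs` — `(Σ_i ρ_i|x_i| + Σ_j σ_j|β_j|)² ≤ (Σρ + Σσ)·(Σ_i ρ_i x_i² + Σ_j σ_j β_j²)` (the remainder is a
  DIAGONAL quadratic form, not `‖z‖²` times a count);
* `couplingGram_image_sub_families_eq` / `abs_couplingGram_image_sub_families_le` — the image of mode `m` minus its
  family part is the remainder combination, bounded by `(Σ_i ρx_i|x_i| + Σ_j ρβ_j|β_j|)·w(m)`;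
* `couplingGram_tail_le` — the tail range alone:
  `Σ_{m∈[B₃,N)} g_m²/d̂_m ≤ ((1+θ)Γ(Px+Qβ) + (1+θ⁻¹)·W·(Σρx+Σρβ)(Σρx_i x_i² + Σρβ_j β_j²))/d₀`;
* **`coupling_majorant_gram`** — with the exact middle range: the hypothesis `hUq` of `weilPositivityOn_of_formatC_cinf`
  with `Uq := Ufin + (tail form)/d₀`, for every `N`.

Pure finite-dimensional real algebra; standard axioms; nothing Weil-specific; no RH claim.
-/

set_option autoImplicit false
-- `Summit.RiemannHypothesis.RiemannHypothesis.…` is the layout-mandated namespace (summit = problem name).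
set_option linter.dupNamespace false

namespace Summit.RiemannHypothesis.RiemannHypothesis.Theorems.WeilFormatC

open Finset

/-! ## Two elementary inequalities -/

/-- **Peter–Paul**: `(t + r)² ≤ (1 + θ)t² + (1 + θ⁻¹)r²` for `θ > 0`. -/
theorem couplingGram_sq_add_le (t r : ℝ) {θ : ℝ} (hθ : 0 < θ) :
    (t + r) ^ 2 ≤ (1 + θ) * t ^ 2 + (1 + 1 / θ) * r ^ 2 := by
  rw [← sub_nonneg]
  have hθ' : θ ≠ 0 := hθ.ne'
  have e : (1 + θ) * t ^ 2 + (1 + 1 / θ) * r ^ 2 - (t + r) ^ 2 = (θ * t - r) ^ 2 / θ := by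
    field_simp
    ring
  rw [e]
  positivity

/-- **Weighted Cauchy–Schwarz for the remainder**: for `ρ, σ ≥ 0`,
`(Σ_i ρ_i|x_i| + Σ_j σ_j|β_j|)² ≤ (Σ_i ρ_i + Σ_j σ_j)·(Σ_i ρ_i x_i² + Σ_j σ_j β_j²)`. -/
theorem couplingGram_weighted_cs {B r : ℕ} (ρ : Fin B → ℝ) (σ : Fin r → ℝ) (hρ : ∀ i, 0 ≤ ρ i)
    (hσ : ∀ j, 0 ≤ σ j) (x : Fin B → ℝ) (β : Fin r → ℝ) :
    (∑ i, ρ i * |x i| + ∑ j, σ j * |β j|) ^ 2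
      ≤ (∑ i, ρ i + ∑ j, σ j) * (∑ i, ρ i * x i ^ 2 + ∑ j, σ j * β j ^ 2) := by
  have h := Finset.sum_mul_sq_le_sq_mul_sq (Finset.univ : Finset (Fin B ⊕ Fin r))
    (Sum.elim (fun i ↦ Real.sqrt (ρ i)) (fun j ↦ Real.sqrt (σ j)))
    (Sum.elim (fun i ↦ Real.sqrt (ρ i) * |x i|) (fun j ↦ Real.sqrt (σ j) * |β j|))
  simp only [Fintype.sum_sum_type, Sum.elim_inl, Sum.elim_inr] at h
  have e1 : ∀ i, Real.sqrt (ρ i) * (Real.sqrt (ρ i) * |x i|) = ρ i * |x i| := fun i ↦ by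
    rw [← mul_assoc, Real.mul_self_sqrt (hρ i)]
  have e2 : ∀ j, Real.sqrt (σ j) * (Real.sqrt (σ j) * |β j|) = σ j * |β j| := fun j ↦ by
    rw [← mul_assoc, Real.mul_self_sqrt (hσ j)]
  have e3 : ∀ i, Real.sqrt (ρ i) ^ 2 = ρ i := fun i ↦ Real.sq_sqrt (hρ i)
  have e4 : ∀ j, Real.sqrt (σ j) ^ 2 = σ j := fun j ↦ Real.sq_sqrt (hσ j)
  have e5 : ∀ i, (Real.sqrt (ρ i) * |x i|) ^ 2 = ρ i * x i ^ 2 := fun i ↦ by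
    rw [mul_pow, Real.sq_sqrt (hρ i), sq_abs]
  have e6 : ∀ j, (Real.sqrt (σ j) * |β j|) ^ 2 = σ j * β j ^ 2 := fun j ↦ by
    rw [mul_pow, Real.sq_sqrt (hσ j), sq_abs]
  simp only [e1, e2, e3, e4, e5, e6] at h
  exact h

/-! ## The image of one mode against its family part -/

/-- **The family part of the image, distributed over the coordinates**:
`ε·Σ_f (Σ_i P(f,i)x_i + Σ_j Q(f,j)β_j)·φ_f = Σ_i (ε Σ_f P(f,i)φ_f)·x_i + Σ_j (ε Σ_f Q(f,j)φ_f)·β_j`. -/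
theorem couplingGram_families_distrib {B r F : ℕ} (ε : ℝ) (φ : Fin F → ℝ) (P : Fin F → Fin B → ℝ)
    (Q : Fin F → Fin r → ℝ) (x : Fin B → ℝ) (β : Fin r → ℝ) :
    ε * ∑ f, (∑ i, P f i * x i + ∑ j, Q f j * β j) * φ f
      = ∑ i, (ε * ∑ f, P f i * φ f) * x i + ∑ j, (ε * ∑ f, Q f j * φ f) * β j := by
  have h1 : ∑ f, (∑ i, P f i * x i + ∑ j, Q f j * β j) * φ f
      = (∑ f, ∑ i, P f i * φ f * x i) + ∑ f, ∑ j, Q f j * φ f * β j := by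
    rw [← Finset.sum_add_distrib]
    refine Finset.sum_congr rfl fun f _ ↦ ?_
    rw [add_mul, Finset.sum_mul, Finset.sum_mul]
    congr 1
    · exact Finset.sum_congr rfl fun i _ ↦ by ring
    · exact Finset.sum_congr rfl fun j _ ↦ by ring
  rw [h1, Finset.sum_comm (f := fun f i ↦ P f i * φ f * x i),
    Finset.sum_comm (f := fun f j ↦ Q f j * φ f * β j), mul_add, Finset.mul_sum, Finset.mul_sum]
  congr 1
  · refine Finset.sum_congr rfl fun i _ ↦ ?_
    rw [Finset.mul_sum, Finset.mul_sum, Finset.sum_mul]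
    exact Finset.sum_congr rfl fun f _ ↦ by ring
  · refine Finset.sum_congr rfl fun j _ ↦ ?_
    rw [Finset.mul_sum, Finset.mul_sum, Finset.sum_mul]
    exact Finset.sum_congr rfl fun f _ ↦ by ring

/-- **Image minus family part = the remainder combination**:
`(Σ_i M_i x_i + Σ_j c_j β_j) − ε·Σ_f u_f φ_f = Σ_i (M_i − εΣ_f P(f,i)φ_f)x_i + Σ_j (c_j − εΣ_f Q(f,j)φ_f)β_j`,
`u_f = Σ_i P(f,i)x_i + Σ_j Q(f,j)β_j`. -/
theorem couplingGram_image_sub_families_eq {B r F : ℕ} (Mi : Fin B → ℝ) (cj : Fin r → ℝ) (ε : ℝ)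
    (φ : Fin F → ℝ) (P : Fin F → Fin B → ℝ) (Q : Fin F → Fin r → ℝ) (x : Fin B → ℝ) (β : Fin r → ℝ) :
    (∑ i, Mi i * x i + ∑ j, cj j * β j) - ε * ∑ f, (∑ i, P f i * x i + ∑ j, Q f j * β j) * φ f
      = ∑ i, (Mi i - ε * ∑ f, P f i * φ f) * x i + ∑ j, (cj j - ε * ∑ f, Q f j * φ f) * β j := by
  rw [couplingGram_families_distrib]
  simp only [sub_mul, Finset.sum_sub_distrib]
  ring

/-- **Remainder bound for one mode**: termwise envelopes `|M_i − εΣ_f P(f,i)φ_f| ≤ ρx_i·w`,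
`|c_j − εΣ_f Q(f,j)φ_f| ≤ ρβ_j·w` give `|image − ε·family part| ≤ (Σ_i ρx_i|x_i| + Σ_j ρβ_j|β_j|)·w`. -/
theorem abs_couplingGram_image_sub_families_le {B r F : ℕ} {Mi : Fin B → ℝ} {cj : Fin r → ℝ} {ε : ℝ}
    {φ : Fin F → ℝ} {P : Fin F → Fin B → ℝ} {Q : Fin F → Fin r → ℝ} {w : ℝ} {ρx : Fin B → ℝ} {ρβ : Fin r → ℝ}
    (hM : ∀ i, |Mi i - ε * ∑ f, P f i * φ f| ≤ ρx i * w) (hc : ∀ j, |cj j - ε * ∑ f, Q f j * φ f| ≤ ρβ j * w)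
    (x : Fin B → ℝ) (β : Fin r → ℝ) :
    |(∑ i, Mi i * x i + ∑ j, cj j * β j) - ε * ∑ f, (∑ i, P f i * x i + ∑ j, Q f j * β j) * φ f|
      ≤ (∑ i, ρx i * |x i| + ∑ j, ρβ j * |β j|) * w := by
  rw [couplingGram_image_sub_families_eq]
  refine (abs_add_le _ _).trans ?_
  rw [add_mul, Finset.sum_mul, Finset.sum_mul]
  refine add_le_add ((Finset.abs_sum_le_sum_abs _ _).trans (Finset.sum_le_sum fun i _ ↦ ?_))
    ((Finset.abs_sum_le_sum_abs _ _).trans (Finset.sum_le_sum fun j _ ↦ ?_))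
  · rw [abs_mul]
    calc |Mi i - ε * ∑ f, P f i * φ f| * |x i| ≤ ρx i * w * |x i| :=
          mul_le_mul_of_nonneg_right (hM i) (abs_nonneg _)
      _ = ρx i * |x i| * w := by ring
  · rw [abs_mul]
    calc |cj j - ε * ∑ f, Q f j * φ f| * |β j| ≤ ρβ j * w * |β j| :=
          mul_le_mul_of_nonneg_right (hc j) (abs_nonneg _)
      _ = ρβ j * |β j| * w := by ring

/-- **Square of one mode's image**: with `ε² = 1` and the remainder bound,
`(image)² ≤ (1+θ)(Σ_f u_f φ_f)² + (1+θ⁻¹)((Σρx|x| + Σρβ|β|)·w)²`. -/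
theorem sq_couplingGram_image_le {B r F : ℕ} {Mi : Fin B → ℝ} {cj : Fin r → ℝ} {ε : ℝ} (hε : ε ^ 2 = 1)
    {φ : Fin F → ℝ} {P : Fin F → Fin B → ℝ} {Q : Fin F → Fin r → ℝ} {w : ℝ} {ρx : Fin B → ℝ} {ρβ : Fin r → ℝ}
    (hM : ∀ i, |Mi i - ε * ∑ f, P f i * φ f| ≤ ρx i * w) (hc : ∀ j, |cj j - ε * ∑ f, Q f j * φ f| ≤ ρβ j * w)
    {θ : ℝ} (hθ : 0 < θ) (x : Fin B → ℝ) (β : Fin r → ℝ) :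
    (∑ i, Mi i * x i + ∑ j, cj j * β j) ^ 2
      ≤ (1 + θ) * (∑ f, (∑ i, P f i * x i + ∑ j, Q f j * β j) * φ f) ^ 2
        + (1 + 1 / θ) * ((∑ i, ρx i * |x i| + ∑ j, ρβ j * |β j|) * w) ^ 2 := by
  set S := ∑ f, (∑ i, P f i * x i + ∑ j, Q f j * β j) * φ f with hS
  set g := ∑ i, Mi i * x i + ∑ j, cj j * β j with hg
  have hr := abs_couplingGram_image_sub_families_le hM hc x β
  rw [← hg, ← hS] at hr
  have hdecomp : g = ε * S + (g - ε * S) := by ring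
  have hpp := couplingGram_sq_add_le (ε * S) (g - ε * S) hθ
  rw [← hdecomp] at hpp
  have hεS : (ε * S) ^ 2 = S ^ 2 := by rw [mul_pow, hε, one_mul]
  rw [hεS] at hpp
  have hsq : (g - ε * S) ^ 2 ≤ ((∑ i, ρx i * |x i| + ∑ j, ρβ j * |β j|) * w) ^ 2 := by
    rw [← sq_abs (g - ε * S)]
    exact pow_le_pow_left₀ (abs_nonneg _) hr 2
  have hθ' : 0 ≤ 1 + 1 / θ := by positivity
  exact hpp.trans (add_le_add le_rfl (mul_le_mul_of_nonneg_left hsq hθ'))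

/-! ## The tail range -/

/-- **The structured tail**: on `[B₃, N)`, with family expansions of rows and images (remainders `ρ·w(m)`,
`Σ w² ≤ W`), a floor `d₀ ≤ d̂`, and any `N`-uniform Gram majorant `Γ` of the families,
`Σ_{m∈[B₃,N)} (Σ_i M(i,m)x_i + Σ_j c(m,j)β_j)²/d̂_m
  ≤ ((1+θ)·Γ(u) + (1+θ⁻¹)·W·(Σρx + Σρβ)·(Σ_i ρx_i x_i² + Σ_j ρβ_j β_j²))/d₀`, `u_f = Σ_i P(f,i)x_i + Σ_j Q(f,j)β_j`. -/
theorem couplingGram_tail_le (M : ℕ → ℕ → ℝ) {B B₃ r F : ℕ} (c : ℕ → Fin r → ℝ) (dhat : ℕ → ℝ)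
    {d₀ : ℝ} (hd₀ : 0 < d₀) (hd₃ : ∀ m, B₃ ≤ m → d₀ ≤ dhat m)
    (ε : ℕ → ℝ) (hε : ∀ m, ε m ^ 2 = 1)
    (φ : Fin F → ℕ → ℝ) (P : Fin F → Fin B → ℝ) (Q : Fin F → Fin r → ℝ)
    (w : ℕ → ℝ) (ρx : Fin B → ℝ) (ρβ : Fin r → ℝ) (hρx : ∀ i, 0 ≤ ρx i) (hρβ : ∀ j, 0 ≤ ρβ j)
    (hM : ∀ m, B₃ ≤ m → ∀ i : Fin B, |M i m - ε m * ∑ f, P f i * φ f m| ≤ ρx i * w m)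
    (hc : ∀ m, B₃ ≤ m → ∀ j : Fin r, |c m j - ε m * ∑ f, Q f j * φ f m| ≤ ρβ j * w m)
    {W : ℝ} (hW : ∀ N, ∑ m ∈ Ico B₃ N, w m ^ 2 ≤ W)
    (Γ : (Fin F → ℝ) → ℝ) (hΓ : ∀ (N : ℕ) (u : Fin F → ℝ), ∑ m ∈ Ico B₃ N, (∑ f, u f * φ f m) ^ 2 ≤ Γ u)
    {θ : ℝ} (hθ : 0 < θ) (N : ℕ) (x : Fin B → ℝ) (β : Fin r → ℝ) :
    ∑ m ∈ Ico B₃ N, (∑ i : Fin B, M i m * x i + ∑ j, c m j * β j) ^ 2 / dhat m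
      ≤ ((1 + θ) * Γ (fun f ↦ ∑ i, P f i * x i + ∑ j, Q f j * β j)
          + (1 + 1 / θ) * (W * ((∑ i, ρx i + ∑ j, ρβ j) * (∑ i, ρx i * x i ^ 2 + ∑ j, ρβ j * β j ^ 2)))) / d₀ := by
  set u : Fin F → ℝ := fun f ↦ ∑ i, P f i * x i + ∑ j, Q f j * β j with hu
  set A := ∑ i, ρx i * |x i| + ∑ j, ρβ j * |β j| with hA
  have hθ' : 0 ≤ 1 + 1 / θ := by positivity
  -- termwise bound on the tail range
  have hterm : ∀ m ∈ Ico B₃ N, (∑ i : Fin B, M i m * x i + ∑ j, c m j * β j) ^ 2 / dhat m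
      ≤ ((1 + θ) * (∑ f, u f * φ f m) ^ 2 + (1 + 1 / θ) * (A ^ 2 * w m ^ 2)) / d₀ := by
    intro m hm
    have hm' : B₃ ≤ m := (Finset.mem_Ico.1 hm).1
    have hdm : d₀ ≤ dhat m := hd₃ m hm'
    have hsq := sq_couplingGram_image_le (hε m) (hM m hm') (hc m hm') hθ x β
    have e : (∑ f, (∑ i, P f i * x i + ∑ j, Q f j * β j) * φ f m) = ∑ f, u f * φ f m := rfl
    rw [e, ← hA, mul_pow] at hsq
    calc (∑ i : Fin B, M i m * x i + ∑ j, c m j * β j) ^ 2 / dhat m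
        ≤ (∑ i : Fin B, M i m * x i + ∑ j, c m j * β j) ^ 2 / d₀ :=
          div_le_div_of_nonneg_left (sq_nonneg _) hd₀ hdm
      _ ≤ _ := div_le_div_of_nonneg_right hsq hd₀.le
  refine (Finset.sum_le_sum hterm).trans ?_
  rw [← Finset.sum_div]
  refine div_le_div_of_nonneg_right ?_ hd₀.le
  rw [Finset.sum_add_distrib, ← Finset.mul_sum, ← Finset.mul_sum, ← Finset.mul_sum]
  refine add_le_add (mul_le_mul_of_nonneg_left (hΓ N u) (by linarith)) (mul_le_mul_of_nonneg_left ?_ hθ')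
  -- `A² Σ w² ≤ W (Σρ)(Σρ z²)`
  have hA2 : A ^ 2 ≤ (∑ i, ρx i + ∑ j, ρβ j) * (∑ i, ρx i * x i ^ 2 + ∑ j, ρβ j * β j ^ 2) :=
    couplingGram_weighted_cs ρx ρβ hρx hρβ x β
  have hW0 : 0 ≤ W := le_trans (Finset.sum_nonneg fun m _ ↦ sq_nonneg (w m)) (hW N)
  calc A ^ 2 * ∑ m ∈ Ico B₃ N, w m ^ 2 ≤ A ^ 2 * W :=
        mul_le_mul_of_nonneg_left (hW N) (sq_nonneg _)
    _ = W * A ^ 2 := mul_comm _ _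
    _ ≤ W * ((∑ i, ρx i + ∑ j, ρβ j) * (∑ i, ρx i * x i ^ 2 + ∑ j, ρβ j * β j ^ 2)) :=
        mul_le_mul_of_nonneg_left hA2 hW0

/-! ## The coupling majorant with a Gram tail -/

/-- **The coupling majorant with a structured tail** (`B ≤ B₃`): an exact majorant `Ufin` on `[B, B₃)`, family expansions
of the rows `M(i,m)` and of the images `c(m,j)` on `[B₃, ∞)` with common sign `ε(m)` (`ε(m)² = 1`), remainders `ρx_i·w(m)`,
`ρβ_j·w(m)` (`ρ ≥ 0`, `Σ_{m∈[B₃,N)} w² ≤ W`), a floor `0 < d₀ ≤ d̂_m` on `[B₃, ∞)` (`d̂ > 0` on `[B, ∞)`), and ANY Gram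
majorant `Γ` of the families (`Σ_{m∈[B₃,N)} (Σ_f u_f φ_f(m))² ≤ Γ(u)` for all `N`, `u`) give, for every `N`, `x`, `β`:
`Σ_{m∈[B,N)} (Σ_i M(i,m)x_i + Σ_j c(m,j)β_j)²/d̂_m
  ≤ Ufin(x,β) + ((1+θ)·Γ(Px + Qβ) + (1+θ⁻¹)·W·(Σρx + Σρβ)·(Σ_i ρx_i x_i² + Σ_j ρβ_j β_j²))/d₀`
— the hypothesis `hUq` of `weilPositivityOn_of_formatC_cinf` with a direction-tracking tail. -/
theorem coupling_majorant_gram (M : ℕ → ℕ → ℝ) {B B₃ r F : ℕ} (hBB : B ≤ B₃) (c : ℕ → Fin r → ℝ)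
    (dhat : ℕ → ℝ) (hd : ∀ m, B ≤ m → 0 < dhat m) {d₀ : ℝ} (hd₀ : 0 < d₀) (hd₃ : ∀ m, B₃ ≤ m → d₀ ≤ dhat m)
    (Ufin : (Fin B → ℝ) → (Fin r → ℝ) → ℝ)
    (hfin : ∀ (x : Fin B → ℝ) (β : Fin r → ℝ),
      ∑ m ∈ Ico B B₃, (∑ i : Fin B, M i m * x i + ∑ j, c m j * β j) ^ 2 / dhat m ≤ Ufin x β)
    (ε : ℕ → ℝ) (hε : ∀ m, ε m ^ 2 = 1)
    (φ : Fin F → ℕ → ℝ) (P : Fin F → Fin B → ℝ) (Q : Fin F → Fin r → ℝ)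
    (w : ℕ → ℝ) (ρx : Fin B → ℝ) (ρβ : Fin r → ℝ) (hρx : ∀ i, 0 ≤ ρx i) (hρβ : ∀ j, 0 ≤ ρβ j)
    (hM : ∀ m, B₃ ≤ m → ∀ i : Fin B, |M i m - ε m * ∑ f, P f i * φ f m| ≤ ρx i * w m)
    (hc : ∀ m, B₃ ≤ m → ∀ j : Fin r, |c m j - ε m * ∑ f, Q f j * φ f m| ≤ ρβ j * w m)
    {W : ℝ} (hW : ∀ N, ∑ m ∈ Ico B₃ N, w m ^ 2 ≤ W)
    (Γ : (Fin F → ℝ) → ℝ) (hΓ : ∀ (N : ℕ) (u : Fin F → ℝ), ∑ m ∈ Ico B₃ N, (∑ f, u f * φ f m) ^ 2 ≤ Γ u)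
    {θ : ℝ} (hθ : 0 < θ) (N : ℕ) (x : Fin B → ℝ) (β : Fin r → ℝ) :
    ∑ m ∈ Ico B N, (∑ i : Fin B, M i m * x i + ∑ j, c m j * β j) ^ 2 / dhat m
      ≤ Ufin x β + ((1 + θ) * Γ (fun f ↦ ∑ i, P f i * x i + ∑ j, Q f j * β j)
          + (1 + 1 / θ) * (W * ((∑ i, ρx i + ∑ j, ρβ j) * (∑ i, ρx i * x i ^ 2 + ∑ j, ρβ j * β j ^ 2)))) / d₀ := by
  have htail := couplingGram_tail_le M c dhat hd₀ hd₃ ε hε φ P Q w ρx ρβ hρx hρβ hM hc hW Γ hΓ hθ N x β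
  -- the tail term is nonnegative (Γ u ≥ 0 from the empty range, W ≥ 0 likewise)
  have hΓ0 : 0 ≤ Γ (fun f ↦ ∑ i, P f i * x i + ∑ j, Q f j * β j) := by
    simpa using hΓ B₃ (fun f ↦ ∑ i, P f i * x i + ∑ j, Q f j * β j)
  have hW0 : 0 ≤ W := by simpa using hW B₃
  have hρz : 0 ≤ ∑ i, ρx i * x i ^ 2 + ∑ j, ρβ j * β j ^ 2 :=
    add_nonneg (Finset.sum_nonneg fun i _ ↦ mul_nonneg (hρx i) (sq_nonneg _))
      (Finset.sum_nonneg fun j _ ↦ mul_nonneg (hρβ j) (sq_nonneg _))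
  have hρs : 0 ≤ ∑ i, ρx i + ∑ j, ρβ j :=
    add_nonneg (Finset.sum_nonneg fun i _ ↦ hρx i) (Finset.sum_nonneg fun j _ ↦ hρβ j)
  have hT0 : 0 ≤ ((1 + θ) * Γ (fun f ↦ ∑ i, P f i * x i + ∑ j, Q f j * β j)
      + (1 + 1 / θ) * (W * ((∑ i, ρx i + ∑ j, ρβ j) * (∑ i, ρx i * x i ^ 2 + ∑ j, ρβ j * β j ^ 2)))) / d₀ := by
    positivity
  rcases le_or_gt N B₃ with hN | hN
  · -- `[B, N) ⊆ [B, B₃)`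
    have hsub : Ico B N ⊆ Ico B B₃ := Finset.Ico_subset_Ico_right hN
    calc ∑ m ∈ Ico B N, (∑ i : Fin B, M i m * x i + ∑ j, c m j * β j) ^ 2 / dhat m
        ≤ ∑ m ∈ Ico B B₃, (∑ i : Fin B, M i m * x i + ∑ j, c m j * β j) ^ 2 / dhat m :=
          Finset.sum_le_sum_of_subset_of_nonneg hsub fun m hm _ ↦ by
            have := hd m (Finset.mem_Ico.1 hm).1; positivity
      _ ≤ Ufin x β := hfin x β
      _ ≤ _ := le_add_of_nonneg_right hT0
  · rw [← Finset.sum_Ico_consecutive _ hBB hN.le]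
    exact add_le_add (hfin x β) htail

end Summit.RiemannHypothesis.RiemannHypothesis.Theorems.WeilFormatC
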